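import Summits.QuantumFields.BalabanUV.Beta.GAN24.SlotChargeMoment
import Summits.QuantumFields.BalabanUV.Beta.GAN24.SlotDivergenceLetters

/-!
# `BalabanUV.Beta.GAN24.WindowSlotRows` — binder row G-an2-4 ∕ (CONV-C), W-slot, the (α-0) parity re-cut, located crux (Q-L-k₀): **THE WINDOW's FIVE SLOT ROWS,
# SUPPLIED** — the three slot-CHARGE rows and the two slot-DIVERGENCE rows that the window theorem of record reads of a table (`hq₂ hq₁ hq₁₂ hD₂ hD₁` of the
# OWNER gan24-p1's `NaturalWindowH1.h1_window_of_dressed_comb` ∕ `NaturalWindowShort` ∕ `NaturalWindowDrift`, = leaf-01 g74's `ThreeLegDoubleFreeze` inputs), obtained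
# (§2) from the two DIVERGENCE rows alone with a constant FREE of the table's own `LocStencil₂` constant and rate — the MEMBERS' form, where the divergences are slaved —,
# and (§3) from the table's `LocStencil₂` shape alone, no smallness — the SOURCES' ∕ level-0 form (G-an2-4 formalisation swarm, leaf prover
# `b2b-balaban-gan24-formalise-leaf-03`, gen 69; journal INTENT [LEAF03-G69-ONLINE] I-leaf03-g69-1; the ASSEMBLER's source ∕ level-0 junction of MY g68 FILE 5
# `WrecAtEvenHalfRowsOfWindows`: (HSL)(HSL′)(HxL0) ⟸ FILE 6 `LegSourceRowsThree`'s (HS)(HS′)(Hx0), and (H3)∕(H3d) in five-row currency ⟸ slaved divergence rows)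

NOT IN PRINT; OUR BOOKKEEPING ([folklore] one-step exponential bookkeeping; 0 `def`, 0 cited facts, 0 `def … : Prop`, 0 sorry).  HONEST FRAMING (cell contract, verbatim):
«discharging `BetaPertH` makes Bałaban's UV stability UNCONDITIONAL — a real constructive-QFT result; it is NOT the continuum limit and NOT the Clay problem.»
HONEST DEPENDENCY (verbatim): «continuum YM on T⁴ ⇐ BetaPertH ∧ nine spine estimates (0/9 proved); BetaPertH ⇐ (D1) ∧ (D4) ∧ CAP+tail; G-an2-4 gates asym, D1
and NE2/3/4.»

NOTHING RE-STATED: the two divergence rows of a `LocStencil₂` table ARE leaf-02 g53's `SlotDivergenceLetters.letter_fst∕snd_of_locStencil₂` (read entrywise), the two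
single charges from the divergence rows are leaf-01 g74's moment device `SlotChargeMoment.abs_tsum_le_of_div_bound` ⨾ `recenter_snd` BY NAME (the two-rate reading of
his `abs_slotCharge_fst∕snd_le`: the table's own constant AND rate serve summability only), the double charge is one more summation inline (the OWNER gan24-p1 g37's part 11
`FiveRowsOfDivergenceRows.abs_doubleCharge_le` proves it as a lemma; part 11 is not in the tree at this filing, so it is not imported) — part 11's `fiveRows_of_divRows` is the
ONE-RATE twin of §2 (table and rows at the same rate); §2's two-rate form is what the comb MEMBERS need (each member is `LocStencil₂` only at a level-dependent rate, 8b
`halfMember_legLetter_mem ….2.2`, while (H3) wants one output rate).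
WHAT (generic `d`, rows spelled as the window's binders: `B6BondElimination.unitVec`, `B12Sec2to5.l1`, `∑'`):
* §1 row arithmetic (rate down, constant up; **`windowRows_weaken`** for the five at once).
* §2 **`exists_windowRows_of_divRows`** — `0 < δ → ∃ Γ ≥ 1, ∀ T g₀, (∃ C₀ δ₀ > 0, LocStencil₂ T C₀ δ₀) → hD₂(g₀, δ) → hD₁(g₀, δ) → ⟨hq₂ ∧ hq₁ ∧ hq₁₂ ∧ hD₂ ∧ hD₁⟩(Γ·g₀, δ∕3)`
  — the constant is FREE of the table's own size and rate (they serve summability only: the ruled class's third conjunct), so slaved divergence rows in ⟹ slaved five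
  rows out: (H3)∕(H3d) in the window's currency.
* §3 **`exists_windowRows_of_locStencil₂`** — `0 < δ → ∃ Γ ≥ 0, ∀ T C, LocStencil₂ T C δ → ⟨five rows⟩(Γ·C, δ∕3)` — no smallness; `Γ` enters LINEARLY, so per-level
  rows `C_F`, geometric rows `C_F′·ν^l` and the level-0 member's `C₀` pass through: (HSL)(HSL′)(HxL0) of FILE 5 from (HS)(HS′)(Hx0) of FILE 6 with `GoodLS :≡` the five
  rows at `δS := δ6∕3`.
Asserts NOTHING about Bałaban's tables; NO value of any charge; NOTHING of (Q-L) ∕ (H1♮) ∕ (H1Δw) ∕ (C)sym discharged; NEVER «G-an2-4 closed» as (CONV-C); NOT D1, NOT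
`BetaPertH`, NOT continuum, NOT Clay; not in print.  Unit `b2b-balaban-gan24-formalise-leaf-03` (gen 69), 2026-08-23.
-/

noncomputable section

open Finset
open scoped BigOperators
open Literature.MathematicalPhysics.QuantumFieldTheory.Balaban1983to89
open Literature.MathematicalPhysics.QuantumFieldTheory.Balaban1983to89.Beta
open B6BondElimination (unitVec)
open B12Sec2to5 (l1 l1_nonneg)
open ExpKernelCalculus (MKer Zl Zl_nonneg summable_exp_shift' tsum_exp_shift' l1_sub_triangle l1_sub_symm)
open OneStepResolventKernel (Fib)
open BalabanCompositeJets (LocStencil₂ LocStencil₂.nonneg)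
open KernelWard (divV)
open Summit.QuantumFields.BalabanUV.Beta.GAN24.BiStencilZeroMode (Tab)
open Summit.QuantumFields.BalabanUV.Beta.GAN24.SlotChargeMoment (abs_tsum_le_of_div_bound recenter_snd)
open Summit.QuantumFields.BalabanUV.Beta.GAN24.SlotDivergenceLetters (letter_fst_of_locStencil₂ letter_snd_of_locStencil₂)

namespace Summit.QuantumFields.BalabanUV.Beta.GAN24.WindowSlotRows

variable {d : ℕ}

/-! ## §1 Row arithmetic: rate down, constant up -/

/-- [folklore] One exponential: `|t| ≤ c·e^{−δs}`, `c ≤ C`, `δ′ ≤ δ`, `0 ≤ s` ⟹ `|t| ≤ C·e^{−δ′s}`. -/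
theorem row_weaken₁ {t c C δ δ' s : ℝ} (hcC : c ≤ C) (hδ : δ' ≤ δ) (hs : 0 ≤ s) (h : |t| ≤ c * Real.exp (-δ * s)) :
    |t| ≤ C * Real.exp (-δ' * s) := by
  have hc : 0 ≤ c := nonneg_of_abs_le_mul_exp h
  refine h.trans (mul_le_mul hcC ?_ (Real.exp_pos _).le (hc.trans hcC))
  rw [Real.exp_le_exp]; nlinarith

/-- [folklore] Two exponentials: `|t| ≤ c·e^{−δs₁}·e^{−δs₂}`, `c ≤ C`, `δ′ ≤ δ`, `0 ≤ s₁, s₂` ⟹ `|t| ≤ C·e^{−δ′s₁}·e^{−δ′s₂}`. -/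
theorem row_weaken₂ {t c C δ δ' s₁ s₂ : ℝ} (hcC : c ≤ C) (hδ : δ' ≤ δ) (hs₁ : 0 ≤ s₁) (hs₂ : 0 ≤ s₂)
    (h : |t| ≤ c * Real.exp (-δ * s₁) * Real.exp (-δ * s₂)) : |t| ≤ C * Real.exp (-δ' * s₁) * Real.exp (-δ' * s₂) := by
  rw [mul_assoc, ← Real.exp_add] at h ⊢
  have e1 : -δ * s₁ + -δ * s₂ = -δ * (s₁ + s₂) := by ring
  have e2 : -δ' * s₁ + -δ' * s₂ = -δ' * (s₁ + s₂) := by ring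
  rw [e1] at h; rw [e2]
  exact row_weaken₁ hcC hδ (add_nonneg hs₁ hs₂) h

/-- [folklore] **THE FIVE ROWS ARE MONOTONE**: constant up (`g ≤ g′`), rate down (`δ′ ≤ δ`). -/
theorem windowRows_weaken {T : Tab d} {g g' δ δ' : ℝ} (hg : g ≤ g') (hδ : δ' ≤ δ)
    (h : (∀ (κ₁ : Fin (d + 1)) (v : Fin (d + 1) → ℤ) (κ₂ : Fin (d + 1)) (x p : Fin (d + 1) → ℤ) (f b : Fib d),
          |∑' v', T κ₁ v κ₂ v' x p f b| ≤ g * Real.exp (-δ * (l1 (x - v) + l1 (p - v)))) ∧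
      (∀ (κ₁ κ₂ : Fin (d + 1)) (v' x p : Fin (d + 1) → ℤ) (f b : Fib d),
          |∑' v, T κ₁ v κ₂ v' x p f b| ≤ g * Real.exp (-δ * (l1 (x - v') + l1 (p - v')))) ∧
      (∀ (κ₁ κ₂ : Fin (d + 1)) (x p : Fin (d + 1) → ℤ) (f b : Fib d),
          |∑' v, ∑' v', T κ₁ v κ₂ v' x p f b| ≤ g * Real.exp (-δ * l1 (p - x))) ∧
      (∀ (κ : Fin (d + 1)) (v w x p : Fin (d + 1) → ℤ) (f b : Fib d),
          |∑ μ, (T κ v μ (w - unitVec μ) x p f b - T κ v μ w x p f b)|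
            ≤ g * Real.exp (-δ * l1 (w - v)) * Real.exp (-δ * (l1 (x - v) + l1 (p - v)))) ∧
      (∀ (κ' : Fin (d + 1)) (w v' x p : Fin (d + 1) → ℤ) (f b : Fib d),
          |∑ κ, (T κ (w - unitVec κ) κ' v' x p f b - T κ w κ' v' x p f b)|
            ≤ g * Real.exp (-δ * l1 (v' - w)) * Real.exp (-δ * (l1 (x - w) + l1 (p - w))))) :
    (∀ (κ₁ : Fin (d + 1)) (v : Fin (d + 1) → ℤ) (κ₂ : Fin (d + 1)) (x p : Fin (d + 1) → ℤ) (f b : Fib d),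
        |∑' v', T κ₁ v κ₂ v' x p f b| ≤ g' * Real.exp (-δ' * (l1 (x - v) + l1 (p - v)))) ∧
    (∀ (κ₁ κ₂ : Fin (d + 1)) (v' x p : Fin (d + 1) → ℤ) (f b : Fib d),
        |∑' v, T κ₁ v κ₂ v' x p f b| ≤ g' * Real.exp (-δ' * (l1 (x - v') + l1 (p - v')))) ∧
    (∀ (κ₁ κ₂ : Fin (d + 1)) (x p : Fin (d + 1) → ℤ) (f b : Fib d),
        |∑' v, ∑' v', T κ₁ v κ₂ v' x p f b| ≤ g' * Real.exp (-δ' * l1 (p - x))) ∧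
    (∀ (κ : Fin (d + 1)) (v w x p : Fin (d + 1) → ℤ) (f b : Fib d),
        |∑ μ, (T κ v μ (w - unitVec μ) x p f b - T κ v μ w x p f b)|
          ≤ g' * Real.exp (-δ' * l1 (w - v)) * Real.exp (-δ' * (l1 (x - v) + l1 (p - v)))) ∧
    (∀ (κ' : Fin (d + 1)) (w v' x p : Fin (d + 1) → ℤ) (f b : Fib d),
        |∑ κ, (T κ (w - unitVec κ) κ' v' x p f b - T κ w κ' v' x p f b)|
          ≤ g' * Real.exp (-δ' * l1 (v' - w)) * Real.exp (-δ' * (l1 (x - w) + l1 (p - w)))) :=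
  ⟨fun κ₁ v κ₂ x p f b => row_weaken₁ hg hδ (add_nonneg (l1_nonneg _) (l1_nonneg _)) (h.1 κ₁ v κ₂ x p f b),
    fun κ₁ κ₂ v' x p f b => row_weaken₁ hg hδ (add_nonneg (l1_nonneg _) (l1_nonneg _)) (h.2.1 κ₁ κ₂ v' x p f b),
    fun κ₁ κ₂ x p f b => row_weaken₁ hg hδ (l1_nonneg _) (h.2.2.1 κ₁ κ₂ x p f b),
    fun κ v w x p f b => row_weaken₂ hg hδ (l1_nonneg _) (add_nonneg (l1_nonneg _) (l1_nonneg _)) (h.2.2.2.1 κ v w x p f b),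
    fun κ' w v' x p f b => row_weaken₂ hg hδ (l1_nonneg _) (add_nonneg (l1_nonneg _) (l1_nonneg _)) (h.2.2.2.2 κ' w v' x p f b)⟩

/-! ## §2 The five rows from the two divergence rows at ANY summability rate — the constant free of the table's own size -/

/-- NOT IN PRINT; OUR BOOKKEEPING.  **THE WINDOW's FIVE SLOT ROWS FROM THE TWO SLOT-DIVERGENCE ROWS, `C`-FREE** (`0 < δ`): there is `Γ = Γ(d, δ) ≥ 1` such that for EVERY
table `T` that is `LocStencil₂` at SOME positive rate (constant and rate serving summability only — the ruled class's third conjunct) whose second-slot divergence row `hD₂` and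
first-slot divergence row `hD₁` hold with constant `g₀` at rate `δ`, the five rows `hq₂ hq₁ hq₁₂ hD₂ hD₁` of the window theorem (`NaturalWindowH1.h1_window_of_dressed_comb`'s
binders) hold with constant `Γ·g₀` at rate `δ∕3` (charges = first moments of the divergences: leaf-01's `abs_tsum_le_of_div_bound` — the two-rate reading of his
`abs_slotCharge_snd∕fst_le` — and `recenter_snd`; the double charge by one more summation; the divergence rows weakened; ONE-RATE twin: the OWNER's part 11
`FiveRowsOfDivergenceRows.fiveRows_of_divRows`).  THE MEMBERS' FORM: slaved divergence rows in ⟹ slaved five rows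
out, whatever the member's own size. -/
theorem exists_windowRows_of_divRows (d : ℕ) {δ : ℝ} (hδ : 0 < δ) :
    ∃ Γ : ℝ, 1 ≤ Γ ∧ ∀ (T : Tab d) (g₀ : ℝ), (∃ C₀ δ₀ : ℝ, 0 < δ₀ ∧ LocStencil₂ T C₀ δ₀) →
      (∀ (κ : Fin (d + 1)) (v w x p : Fin (d + 1) → ℤ) (f b : Fib d),
          |∑ μ, (T κ v μ (w - unitVec μ) x p f b - T κ v μ w x p f b)|
            ≤ g₀ * Real.exp (-δ * l1 (w - v)) * Real.exp (-δ * (l1 (x - v) + l1 (p - v)))) →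
      (∀ (κ' : Fin (d + 1)) (w v' x p : Fin (d + 1) → ℤ) (f b : Fib d),
          |∑ κ, (T κ (w - unitVec κ) κ' v' x p f b - T κ w κ' v' x p f b)|
            ≤ g₀ * Real.exp (-δ * l1 (v' - w)) * Real.exp (-δ * (l1 (x - w) + l1 (p - w)))) →
      (∀ (κ₁ : Fin (d + 1)) (v : Fin (d + 1) → ℤ) (κ₂ : Fin (d + 1)) (x p : Fin (d + 1) → ℤ) (f b : Fib d),
          |∑' v', T κ₁ v κ₂ v' x p f b| ≤ Γ * g₀ * Real.exp (-(δ / 3) * (l1 (x - v) + l1 (p - v)))) ∧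
      (∀ (κ₁ κ₂ : Fin (d + 1)) (v' x p : Fin (d + 1) → ℤ) (f b : Fib d),
          |∑' v, T κ₁ v κ₂ v' x p f b| ≤ Γ * g₀ * Real.exp (-(δ / 3) * (l1 (x - v') + l1 (p - v')))) ∧
      (∀ (κ₁ κ₂ : Fin (d + 1)) (x p : Fin (d + 1) → ℤ) (f b : Fib d),
          |∑' v, ∑' v', T κ₁ v κ₂ v' x p f b| ≤ Γ * g₀ * Real.exp (-(δ / 3) * l1 (p - x))) ∧
      (∀ (κ : Fin (d + 1)) (v w x p : Fin (d + 1) → ℤ) (f b : Fib d),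
          |∑ μ, (T κ v μ (w - unitVec μ) x p f b - T κ v μ w x p f b)|
            ≤ Γ * g₀ * Real.exp (-(δ / 3) * l1 (w - v)) * Real.exp (-(δ / 3) * (l1 (x - v) + l1 (p - v)))) ∧
      (∀ (κ' : Fin (d + 1)) (w v' x p : Fin (d + 1) → ℤ) (f b : Fib d),
          |∑ κ, (T κ (w - unitVec κ) κ' v' x p f b - T κ w κ' v' x p f b)|
            ≤ Γ * g₀ * Real.exp (-(δ / 3) * l1 (v' - w)) * Real.exp (-(δ / 3) * (l1 (x - w) + l1 (p - w)))) := by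
  -- the three charge constants (per unit of `g₀`)
  set A₂ : ℝ := 2 / δ * Zl (d + 1) (δ / 2) with hA₂
  set A₁ : ℝ := 2 / (δ / 3) * Zl (d + 1) (δ / 3 / 2) with hA₁
  set A₁₂ : ℝ := A₂ * Zl (d + 1) (δ / 2) with hA₁₂
  have hA₂0 : 0 ≤ A₂ := by rw [hA₂]; exact mul_nonneg (by positivity) (Zl_nonneg (by positivity))
  have hA₁0 : 0 ≤ A₁ := by rw [hA₁]; exact mul_nonneg (by positivity) (Zl_nonneg (by positivity))
  have hA₁₂0 : 0 ≤ A₁₂ := by rw [hA₁₂]; exact mul_nonneg hA₂0 (Zl_nonneg (by positivity))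
  refine ⟨1 + A₂ + A₁ + A₁₂, by linarith, ?_⟩
  rintro T g₀ ⟨C₀, δ₀, hδ₀, hT⟩ hD₂ hD₁
  have hC₀ : 0 ≤ C₀ := hT.nonneg
  have hδ3 : δ / 3 ≤ δ := by linarith
  have hδ32 : δ / 3 ≤ δ / 2 := by linarith
  have hg₀ : 0 ≤ g₀ := by
    have h0 := hD₂ 0 0 0 0 0 (Sum.inl 0) (Sum.inl 0)
    rw [sub_self, show l1 (0 : Fin (d + 1) → ℤ) = 0 by simp [l1], mul_zero, add_zero, mul_zero, Real.exp_zero, mul_one, mul_one] at h0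
    exact (abs_nonneg _).trans h0
  -- summability envelopes of the two slices, from the table's own shape at rate `δ₀` (the second factor dropped)
  have hf₂ : ∀ (κ : Fin (d + 1)) (v x z : Fin (d + 1) → ℤ) (a b : Fib d) (μ : Fin (d + 1)) (y : Fin (d + 1) → ℤ),
      |T κ v μ y x z a b| ≤ C₀ * Real.exp (-δ₀ * l1 (y - v)) := by
    intro κ v x z a b μ y
    refine (hT κ v μ y x z a b).trans ?_
    have h1 : Real.exp (-δ₀ * (l1 (x - v) + l1 (z - v))) ≤ 1 := by
      rw [Real.exp_le_one_iff]; have := l1_nonneg (x - v); have := l1_nonneg (z - v); nlinarith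
    calc C₀ * Real.exp (-δ₀ * l1 (y - v)) * Real.exp (-δ₀ * (l1 (x - v) + l1 (z - v))) ≤ C₀ * Real.exp (-δ₀ * l1 (y - v)) * 1 := by gcongr
      _ = _ := mul_one _
  have hf₁ : ∀ (κ' : Fin (d + 1)) (v' x z : Fin (d + 1) → ℤ) (a b : Fib d) (μ : Fin (d + 1)) (y : Fin (d + 1) → ℤ),
      |T μ y κ' v' x z a b| ≤ C₀ * Real.exp (-δ₀ * l1 (y - v')) := by
    intro κ' v' x z a b μ y
    refine (hT μ y κ' v' x z a b).trans ?_
    have h1 : Real.exp (-δ₀ * (l1 (x - y) + l1 (z - y))) ≤ 1 := by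
      rw [Real.exp_le_one_iff]; have := l1_nonneg (x - y); have := l1_nonneg (z - y); nlinarith
    rw [l1_sub_symm v' y]
    calc C₀ * Real.exp (-δ₀ * l1 (y - v')) * Real.exp (-δ₀ * (l1 (x - y) + l1 (z - y))) ≤ C₀ * Real.exp (-δ₀ * l1 (y - v')) * 1 := by gcongr
      _ = _ := mul_one _
  -- the second-slot charge row at rate `δ` (the first moment of the second-slot divergence, centred at the first slot)
  have hQ₂ : ∀ (κ₁ : Fin (d + 1)) (v : Fin (d + 1) → ℤ) (κ₂ : Fin (d + 1)) (x p : Fin (d + 1) → ℤ) (f b : Fib d),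
      |∑' v', T κ₁ v κ₂ v' x p f b| ≤ g₀ * A₂ * Real.exp (-δ * (l1 (x - v) + l1 (p - v))) := by
    intro κ₁ v κ₂ x p f b
    have hdiv : ∀ y, |∑ μ, (T κ₁ v μ (y - unitVec μ) x p f b - T κ₁ v μ y x p f b)|
        ≤ (g₀ * Real.exp (-δ * (l1 (x - v) + l1 (p - v)))) * Real.exp (-δ * l1 (y - v)) := fun y =>
      (hD₂ κ₁ v y x p f b).trans (le_of_eq (by ring))
    have h := abs_tsum_le_of_div_bound (f := fun μ y => T κ₁ v μ y x p f b) hδ₀ hδ (hf₂ κ₁ v x p f b) hdiv κ₂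
    rw [hA₂]; refine h.trans (le_of_eq ?_); ring
  -- the first-slot charge row at rate `δ/3` (centred at the second slot: `recenter_snd`)
  have hQ₁ : ∀ (κ₁ κ₂ : Fin (d + 1)) (v' x p : Fin (d + 1) → ℤ) (f b : Fib d),
      |∑' v, T κ₁ v κ₂ v' x p f b| ≤ g₀ * A₁ * Real.exp (-(δ / 3) * (l1 (x - v') + l1 (p - v'))) := by
    intro κ₁ κ₂ v' x p f b
    have hdiv : ∀ y, |∑ μ, (T μ (y - unitVec μ) κ₂ v' x p f b - T μ y κ₂ v' x p f b)|
        ≤ (g₀ * Real.exp (-(δ / 3) * (l1 (x - v') + l1 (p - v')))) * Real.exp (-(δ / 3) * l1 (y - v')) := by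
      intro y
      refine (hD₁ κ₂ y v' x p f b).trans ?_
      rw [mul_assoc, mul_assoc]
      exact mul_le_mul_of_nonneg_left (recenter_snd hδ.le y v' x p) hg₀
    have h := abs_tsum_le_of_div_bound (f := fun μ y => T μ y κ₂ v' x p f b) hδ₀ (by positivity : 0 < δ / 3) (hf₁ κ₂ v' x p f b) hdiv κ₁
    rw [hA₁]; refine h.trans (le_of_eq ?_); ring
  -- the double charge at rate `δ/2`: one more summation over the first slot (`|p−x|₁ ≤ |p−v|₁ + |v−x|₁`; the OWNER's part 11 `abs_doubleCharge_le` proves the same —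
  -- re-derived inline here because part 11 is not yet in the tree)
  have hQ₁₂ : ∀ (κ₁ κ₂ : Fin (d + 1)) (x p : Fin (d + 1) → ℤ) (f b : Fib d),
      |∑' v, ∑' v', T κ₁ v κ₂ v' x p f b| ≤ g₀ * A₁₂ * Real.exp (-(δ / 2) * l1 (p - x)) := by
    intro κ₁ κ₂ x p f b
    have hgA : 0 ≤ g₀ * A₂ := mul_nonneg hg₀ hA₂0
    have hpt : ∀ v : Fin (d + 1) → ℤ,
        |∑' v', T κ₁ v κ₂ v' x p f b| ≤ (g₀ * A₂ * Real.exp (-(δ / 2) * l1 (p - x))) * Real.exp (-(δ / 2) * l1 (v - x)) := by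
      intro v
      refine (hQ₂ κ₁ v κ₂ x p f b).trans ?_
      rw [mul_assoc (g₀ * A₂), ← Real.exp_add]
      refine mul_le_mul_of_nonneg_left ?_ hgA
      rw [Real.exp_le_exp]
      have h1 := l1_sub_triangle p v x
      have h2 := l1_sub_symm x v
      have h3 := l1_nonneg (x - v)
      have h4 := l1_nonneg (p - v)
      nlinarith
    have hs := (summable_exp_shift' (half_pos hδ) x).mul_left (g₀ * A₂ * Real.exp (-(δ / 2) * l1 (p - x)))
    have hb := tsum_of_norm_bounded hs.hasSum (f := fun v => ∑' v', T κ₁ v κ₂ v' x p f b) fun v => by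
      rw [Real.norm_eq_abs]; exact hpt v
    rw [Real.norm_eq_abs, tsum_mul_left, tsum_exp_shift'] at hb
    rw [hA₁₂]; refine hb.trans (le_of_eq ?_); ring
  -- constants up to `Γ·g₀`, rates down to `δ/3`
  have hΓ2 : g₀ * A₂ ≤ (1 + A₂ + A₁ + A₁₂) * g₀ := by nlinarith
  have hΓ1 : g₀ * A₁ ≤ (1 + A₂ + A₁ + A₁₂) * g₀ := by nlinarith
  have hΓ12 : g₀ * A₁₂ ≤ (1 + A₂ + A₁ + A₁₂) * g₀ := by nlinarith
  have hΓ0 : g₀ ≤ (1 + A₂ + A₁ + A₁₂) * g₀ := by nlinarith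
  refine ⟨fun κ₁ v κ₂ x p f b => ?_, fun κ₁ κ₂ v' x p f b => ?_, fun κ₁ κ₂ x p f b => ?_, fun κ v w x p f b => ?_, fun κ' w v' x p f b => ?_⟩
  · exact row_weaken₁ hΓ2 hδ3 (add_nonneg (l1_nonneg _) (l1_nonneg _)) (hQ₂ κ₁ v κ₂ x p f b)
  · exact row_weaken₁ hΓ1 le_rfl (add_nonneg (l1_nonneg _) (l1_nonneg _)) (hQ₁ κ₁ κ₂ v' x p f b)
  · exact row_weaken₁ hΓ12 hδ32 (l1_nonneg _) (hQ₁₂ κ₁ κ₂ x p f b)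
  · exact row_weaken₂ hΓ0 hδ3 (l1_nonneg _) (add_nonneg (l1_nonneg _) (l1_nonneg _)) (hD₂ κ v w x p f b)
  · exact row_weaken₂ hΓ0 hδ3 (l1_nonneg _) (add_nonneg (l1_nonneg _) (l1_nonneg _)) (hD₁ κ' w v' x p f b)

/-! ## §3 The five rows from the table's `LocStencil₂` shape alone — the sources' form -/

/-- NOT IN PRINT; OUR BOOKKEEPING.  **THE WINDOW's FIVE SLOT ROWS OF ANY `LocStencil₂` TABLE, NO SMALLNESS** (`0 < δ`): there is `Γ = Γ(d, δ) ≥ 0` such that EVERY table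
with `LocStencil₂ T C δ` satisfies the five rows `hq₂ hq₁ hq₁₂ hD₂ hD₁` with constant `Γ·C` at rate `δ∕3` (the divergence rows by leaf-02's `letter_snd∕fst_of_locStencil₂` with
`g₀ := (d+1)(e^{3δ}+1)·C`, then §2).  THE SOURCES' ∕ LEVEL-0 FORM: `Γ` enters linearly, so per-level constants `C_F`, geometric ones `C_F′·ν^l` and the initial member's `C₀`
pass through unchanged — (HSL)(HSL′)(HxL0) of `WrecAtEvenHalfRowsOfWindows` from (HS)(HS′)(Hx0) of `LegSourceRowsThree`, `GoodLS :≡` the five rows at a third of the rate. -/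
theorem exists_windowRows_of_locStencil₂ (d : ℕ) {δ : ℝ} (hδ : 0 < δ) :
    ∃ Γ : ℝ, 0 ≤ Γ ∧ ∀ (T : Tab d) (C : ℝ), LocStencil₂ T C δ →
      (∀ (κ₁ : Fin (d + 1)) (v : Fin (d + 1) → ℤ) (κ₂ : Fin (d + 1)) (x p : Fin (d + 1) → ℤ) (f b : Fib d),
          |∑' v', T κ₁ v κ₂ v' x p f b| ≤ Γ * C * Real.exp (-(δ / 3) * (l1 (x - v) + l1 (p - v)))) ∧
      (∀ (κ₁ κ₂ : Fin (d + 1)) (v' x p : Fin (d + 1) → ℤ) (f b : Fib d),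
          |∑' v, T κ₁ v κ₂ v' x p f b| ≤ Γ * C * Real.exp (-(δ / 3) * (l1 (x - v') + l1 (p - v')))) ∧
      (∀ (κ₁ κ₂ : Fin (d + 1)) (x p : Fin (d + 1) → ℤ) (f b : Fib d),
          |∑' v, ∑' v', T κ₁ v κ₂ v' x p f b| ≤ Γ * C * Real.exp (-(δ / 3) * l1 (p - x))) ∧
      (∀ (κ : Fin (d + 1)) (v w x p : Fin (d + 1) → ℤ) (f b : Fib d),
          |∑ μ, (T κ v μ (w - unitVec μ) x p f b - T κ v μ w x p f b)|
            ≤ Γ * C * Real.exp (-(δ / 3) * l1 (w - v)) * Real.exp (-(δ / 3) * (l1 (x - v) + l1 (p - v)))) ∧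
      (∀ (κ' : Fin (d + 1)) (w v' x p : Fin (d + 1) → ℤ) (f b : Fib d),
          |∑ κ, (T κ (w - unitVec κ) κ' v' x p f b - T κ w κ' v' x p f b)|
            ≤ Γ * C * Real.exp (-(δ / 3) * l1 (v' - w)) * Real.exp (-(δ / 3) * (l1 (x - w) + l1 (p - w)))) := by
  obtain ⟨Γ₁, hΓ₁, hrows⟩ := exists_windowRows_of_divRows d hδ
  set E : ℝ := ((d : ℝ) + 1) * (Real.exp (3 * δ) + 1) with hE
  have hE0 : 0 ≤ E := by rw [hE]; positivity
  refine ⟨Γ₁ * E, mul_nonneg (by linarith) hE0, ?_⟩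
  intro T C hT
  have hC : 0 ≤ C := hT.nonneg
  -- the two divergence rows of a `LocStencil₂` table (leaf-02's letters, read entrywise), common constant `E·C`
  have h13 : Real.exp δ ≤ Real.exp (3 * δ) := Real.exp_le_exp.mpr (by linarith)
  have hD₂ : ∀ (κ : Fin (d + 1)) (v w x p : Fin (d + 1) → ℤ) (f b : Fib d),
      |∑ μ, (T κ v μ (w - unitVec μ) x p f b - T κ v μ w x p f b)|
        ≤ E * C * Real.exp (-δ * l1 (w - v)) * Real.exp (-δ * (l1 (x - v) + l1 (p - v))) := by
    intro κ v w x p f b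
    have e : ∑ μ, (T κ v μ (w - unitVec μ) x p f b - T κ v μ w x p f b) = divV (fun κ₁ u₁ => T κ v κ₁ u₁) w x p f b := by
      simp only [KernelWard.divV, Finset.sum_apply, Pi.sub_apply]
    rw [e]
    refine (letter_snd_of_locStencil₂ hT hδ.le κ v w x p f b).trans ?_
    have hle : ((d : ℝ) + 1) * (Real.exp δ + 1) * C ≤ E * C := by
      rw [hE]; exact mul_le_mul_of_nonneg_right (mul_le_mul_of_nonneg_left (by linarith) (by positivity)) hC
    exact mul_le_mul_of_nonneg_right (mul_le_mul_of_nonneg_right hle (Real.exp_pos _).le) (Real.exp_pos _).le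
  have hD₁ : ∀ (κ' : Fin (d + 1)) (w v' x p : Fin (d + 1) → ℤ) (f b : Fib d),
      |∑ κ, (T κ (w - unitVec κ) κ' v' x p f b - T κ w κ' v' x p f b)|
        ≤ E * C * Real.exp (-δ * l1 (v' - w)) * Real.exp (-δ * (l1 (x - w) + l1 (p - w))) := by
    intro κ' w v' x p f b
    have e : ∑ κ, (T κ (w - unitVec κ) κ' v' x p f b - T κ w κ' v' x p f b) = divV (fun κ₁ u₁ => T κ₁ u₁ κ' v') w x p f b := by
      simp only [KernelWard.divV, Finset.sum_apply, Pi.sub_apply]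
    rw [e, hE]
    exact letter_fst_of_locStencil₂ hT hδ.le w κ' v' x p f b
  have h := hrows T (E * C) ⟨C, δ, hδ, hT⟩ hD₂ hD₁
  have key : Γ₁ * (E * C) = Γ₁ * E * C := by ring
  simp only [key] at h
  exact h

end Summit.QuantumFields.BalabanUV.Beta.GAN24.WindowSlotRows

end
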